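import Literature.Analysis.FluidPDE.TorusNSBeiraoDaVeigaCriterion
import Literature.Analysis.FunctionSpaces.TorusSobolevGagliardoNirenberg
import HarnessLib

/-!
# Row `n = 2` of Gibbon's chessboard as a sufficient condition on `T³`, squares `(2, m)` with
# `2m < 3`: `∫₀ᵀ ‖∇²u‖_{L^{2m}}^{4m/(6m−3)} dt < ∞` suffices (continuation form)

search for candidate a priori estimates; no regularity claim (cell `pub-nsfunc`, literature seat:
this file types a PUBLISHED criterion, nothing new).

Analysis/FluidPDE proof file (theorems only; no definitions, no named facts), sequel of
`TorusNSLaplacianL43Criterion.lean` (the square `(2,1)`). Gibbon (J. Nonlinear Sci. 29 (2019),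
Thm 2 (iii) with Remark 2): for `n ≥ 1`, `1 ≤ m ≤ ∞`, `α_{n,m} = 2m/(2m(n+1)−3)`, a sufficient
condition for strong solutions is `M_{n,m,T}(u) = ∫₀ᵀ ‖∇ⁿu‖_{L^{2m}}^{2α_{n,m}} dt < ∞`. Row `n = 2`
reads `∫₀ᵀ ‖∇²u‖_{2m}^{4m/(6m−3)} dt < ∞`; writing `q = 2m`, the time exponent is `2q/(3(q−1))` and
`2/r + 3/q = 3` (the scaling-critical line for second derivatives of the velocity).

The printed proof (Appendix B) runs through local existence in `Ẇ^{n,2m}`; here — as for the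
square `(2,1)` — the squares with `2m < 3` are reduced to Beirão da Veiga's gradient criterion
(`∇u ∈ L^{r}(0,T; L^s)`, `2/r + 3/s = 2`, `3/2 < s < ∞`; tree:
`Torus.classicalNS_continuation_of_gradLs_rpow_integral_le`) through the periodic Sobolev embedding
`W^{2,q}(𝕋³) ⊂ W^{1,q*}(𝕋³)`, `q* = 3q/(3−q)` (Robinson–Rodrigo–Sadowski 2016 Thm 1.7 (i) +
Thm 1.9 (iii); tree `Torus.exists_integral_partialDeriv_rpow_le_hessian` of
`TorusSobolevGagliardoNirenberg`): `2s/(2s−3) = 2q/(3(q−1))` at `s = q*`.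

* `Torus.exists_gradLs_le_hessianLq` — `(∫|∇v|^s)^{1/s} ≤ C (∫|∇²v|^q)^{1/q}` for smooth vector
  fields on `T³`, `1 ≤ q < 3`, `1 ≤ s`, `1/q − 1/3 ≤ 1/s`, with `|∇v| = (∑ⱼ‖∂ⱼv‖²)^{1/2}` and
  `|∇²v| = (∑ᵢ∑ⱼ‖∂ⱼ∂ᵢv‖²)^{1/2}`.
* `Torus.classicalNS_continuation_of_hessianLq_rpow_integral_le` — **the squares `(2, q/2)`,
  `1 < q < 3`, on `T³`, continuation form**: along a classical solution of the unforced
  Navier–Stokes equations (`ν > 0`, mean-zero slices) on `[0, T) × T^d`, a continuous majorant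
  `N(t) ≥ ‖∇²u(t)‖_{L^q}` with `∫₀ᵗ N^{2q/(3(q−1))} ≤ I` on `[0, T)` gives continuation past `T`.

Scope (faithfulness): classical solutions with mean-zero slices on the unit torus; the squares
`(2,m)` with `1 ≤ m < 3/2` of Thm 2 (iii) (and, beyond print, `1/2 < m < 1`); `m ≥ 3/2`
(`2α_{2,m} ≤ 1`) needs the printed `Ẇ^{2,2m}` local-existence route and is not attempted.

## Mathlib / tree search

Tree (used): `Torus.classicalNS_continuation_of_gradLs_rpow_integral_le`
(`TorusNSBeiraoDaVeigaCriterion`), `Torus.exists_integral_partialDeriv_rpow_le_hessian`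
(`TorusSobolevGagliardoNirenberg`); `(2,1)`: `TorusNSLaplacianL43Criterion`. Searched
`hessian.*continuation|W2q|nabla\^2 u.*L\^\{2m\}` under `Literature/`: nothing beyond `(2,1)`.

## References

* [Gibbon2019Chessboard] J. D. Gibbon, *Weak and strong solutions of the 3D Navier–Stokes
  equations and their relation to a chessboard of convergent inverse length scales*,
  J. Nonlinear Sci. 29 (2019) 215–228 = arXiv:1803.11518, Thm 2 (iii), Remark 2 (row `n = 2`).
* [BeiraoDaVeiga1995] H. Beirão da Veiga, Chinese Ann. Math. Ser. B 16 (1995) 407–412.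
* [RobinsonRodrigoSadowskiCUP2016] Thm 1.7 (i), Thm 1.9 (iii) (Sobolev on `𝕋³`).
-/

noncomputable section

open Set MeasureTheory intervalIntegral Filter Real
open scoped InnerProductSpace RealInnerProductSpace Topology ENNReal NNReal

namespace Literature.Analysis.FluidPDE

open Literature.Analysis.FunctionSpaces

variable {d : Type*} [Fintype d] [DecidableEq d]

omit [DecidableEq d] in
/-- Minkowski in Bochner form on the torus: for continuous nonnegative `g, g₁, …` with
`g ≤ ∑ₖ gₖ` pointwise and `1 ≤ s`, `(∫ g^s)^{1/s} ≤ ∑ₖ (∫ gₖ^s)^{1/s}` (private copy of the lemma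
of `TorusNSPressureHessianCriterion`, not imported here). [folklore] -/
private theorem integral_rpow_le_sum_of_le_sum' {ι : Type*} [Fintype ι] {s : ℝ} (hs : 1 ≤ s)
    {g : UnitAddTorus d → ℝ} {G : ι → UnitAddTorus d → ℝ} (hgc : Continuous g)
    (hGc : ∀ k, Continuous (G k)) (hg0 : ∀ x, 0 ≤ g x) (hG0 : ∀ k x, 0 ≤ G k x)
    (hle : ∀ x, g x ≤ ∑ k, G k x) :
    (∫ x, g x ^ s) ^ (1 / s) ≤ ∑ k, (∫ x, G k x ^ s) ^ (1 / s) := by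
  have hs0 : 0 < s := by linarith
  set pr : ℝ≥0∞ := ENNReal.ofReal s with hpr
  have hp1 : 1 ≤ pr := by rw [hpr]; exact ENNReal.one_le_ofReal.2 hs
  have hp0 : pr ≠ 0 := (zero_lt_one.trans_le hp1).ne'
  have hptop : pr ≠ ⊤ := ENNReal.ofReal_ne_top
  have htoReal : pr.toReal = s := ENNReal.toReal_ofReal hs0.le
  have conv : ∀ {φ : UnitAddTorus d → ℝ}, Continuous φ → (∀ x, 0 ≤ φ x) →
      eLpNorm φ pr volume = ENNReal.ofReal ((∫ x, φ x ^ s) ^ (1 / s)) := by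
    intro φ hφ hφ0
    rw [MemLp.eLpNorm_eq_integral_rpow_norm hp0 hptop
      (hφ.memLp_of_hasCompactSupport (HasCompactSupport.of_compactSpace φ)), htoReal, one_div]
    congr 2
    exact integral_congr_ae (ae_of_all _ fun x => by
      simp only [Real.norm_eq_abs, abs_of_nonneg (hφ0 x)])
  have h1 : eLpNorm g pr volume ≤ ∑ k, eLpNorm (G k) pr volume := by
    have hle' : eLpNorm g pr volume ≤ eLpNorm (fun x => ∑ k, G k x) pr volume :=
      eLpNorm_mono_real fun x => by
        rw [Real.norm_eq_abs, abs_of_nonneg (hg0 x)]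
        exact hle x
    have e : (fun x => ∑ k, G k x) = ∑ k, G k := by
      funext x
      simp only [Finset.sum_apply]
    rw [e] at hle'
    exact hle'.trans (eLpNorm_sum_le (fun k _ => (hGc k).aestronglyMeasurable) hp1)
  rw [conv hgc hg0] at h1
  have e2 : ∑ k, eLpNorm (G k) pr volume = ENNReal.ofReal (∑ k, (∫ x, G k x ^ s) ^ (1 / s)) := by
    rw [ENNReal.ofReal_sum_of_nonneg fun k _ =>
      Real.rpow_nonneg (integral_nonneg fun x => Real.rpow_nonneg (hG0 k x) _) _]
    exact Finset.sum_congr rfl fun k _ => conv (hGc k) (hG0 k)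
  rw [e2] at h1
  exact (ENNReal.ofReal_le_ofReal_iff (Finset.sum_nonneg fun k _ =>
    Real.rpow_nonneg (integral_nonneg fun x => Real.rpow_nonneg (hG0 k x) _) _)).1 h1

/-- `√(∑ aᵢ²) ≤ ∑ aᵢ` for `aᵢ ≥ 0`. [folklore] -/
private theorem sqrt_sum_sq_le_sum' {ι : Type*} [Fintype ι] (a : ι → ℝ) (ha : ∀ i, 0 ≤ a i) :
    Real.sqrt (∑ i, a i ^ 2) ≤ ∑ i, a i := by
  have hS : 0 ≤ ∑ i, a i := Finset.sum_nonneg fun i _ => ha i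
  refine Real.sqrt_le_iff.2 ⟨hS, ?_⟩
  calc ∑ i, a i ^ 2 = ∑ i, a i * a i := Finset.sum_congr rfl fun i _ => sq (a i)
    _ ≤ ∑ i, a i * ∑ k, a k := Finset.sum_le_sum fun i _ =>
        mul_le_mul_of_nonneg_left (Finset.single_le_sum (fun k _ => ha k) (Finset.mem_univ i))
          (ha i)
    _ = (∑ i, a i) ^ 2 := by rw [← Finset.sum_mul]; ring

/-! ### The static Sobolev step `‖∇v‖_{L^s} ≤ C ‖∇²v‖_{L^q}` for vector fields on `T³` -/

/-- **`(∫|∇v|^s)^{1/s} ≤ C (∫|∇²v|^q)^{1/q}` for smooth vector fields on `T³`** (the Sobolev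
embedding `W^{2,q}(𝕋³) ⊂ W^{1,q*}(𝕋³)`; Robinson–Rodrigo–Sadowski 2016 Thm 1.7 (i) with the
Poincaré inequality Thm 1.9 (iii) for the zero-mean derivatives `∂ⱼv`): on `T^d`, `card d = 3`,
for `1 ≤ q < 3`, `1 ≤ s`, `1/q − 1/3 ≤ 1/s` there is `C ≥ 0` with
`(∫ (∑ⱼ‖∂ⱼv‖²)^{s/2})^{1/s} ≤ C (∫ (∑ᵢ∑ⱼ‖∂ⱼ∂ᵢv‖²)^{q/2})^{1/q}` for every smooth
`v : T^d → ℝ^d` (`|∇v| ≤ ∑ⱼ‖∂ⱼv‖`, Minkowski, `Torus.exists_integral_partialDeriv_rpow_le_hessian`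
for each `j`, and `(∑ᵢ‖∂ᵢ∂ⱼv‖²)^{q/2} ≤ (∑ⱼ'∑ᵢ‖∂ᵢ∂ⱼ'v‖²)^{q/2}`).
[cite: RobinsonRodrigoSadowskiCUP2016, Thm 1.7 (i) and Thm 1.9 (iii)] -/
theorem Torus.exists_gradLs_le_hessianLq (hd : Fintype.card d = 3) {q s : ℝ} (hq : 1 ≤ q)
    (hq3 : q < 3) (hs : 1 ≤ s) (hqs : 1 / q - 1 / 3 ≤ 1 / s) :
    ∃ C : ℝ, 0 ≤ C ∧ ∀ v : UnitAddTorus d → EuclideanSpace ℝ d, Torus.IsSmooth v →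
      (∫ x, Real.sqrt (∑ j, ‖Torus.partialDeriv j v x‖ ^ 2) ^ s) ^ (1 / s) ≤
        C * (∫ x, (∑ i, ∑ j, ‖Torus.partialDeriv j (Torus.partialDeriv i v) x‖ ^ 2) ^ (q / 2)) ^
          (1 / q) := by
  have hs0 : 0 < s := by linarith
  have hq0 : 0 < q := by linarith
  obtain ⟨C₀, hC₀0, hC₀⟩ := Torus.exists_integral_partialDeriv_rpow_le_hessian (d := d)
    (F' := EuclideanSpace ℝ d) hd hq hq3 hs0 hqs
  refine ⟨Fintype.card d * C₀, by positivity, fun v hv => ?_⟩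
  set H : UnitAddTorus d → ℝ :=
    fun x => ∑ i, ∑ j, ‖Torus.partialDeriv j (Torus.partialDeriv i v) x‖ ^ 2 with hH
  set B : ℝ := (∫ x, H x ^ (q / 2)) ^ (1 / q) with hB
  have hH0 : ∀ x, 0 ≤ H x := fun x =>
    Finset.sum_nonneg fun i _ => Finset.sum_nonneg fun j _ => sq_nonneg _
  have hD2c : ∀ i j, Continuous (Torus.partialDeriv j (Torus.partialDeriv i v)) :=
    fun i j => ((hv.partialDeriv i).partialDeriv j).continuous
  have hHc : Continuous H :=
    continuous_finsetSum _ fun i _ => continuous_finsetSum _ fun j _ => ((hD2c i j).norm).pow 2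
  -- each component: `(∫‖∂ⱼv‖^s)^{1/s} ≤ C₀ B`
  have hcomp : ∀ i, (∫ x, ‖Torus.partialDeriv i v x‖ ^ s) ^ (1 / s) ≤ C₀ * B := by
    intro i
    refine (hC₀ v hv i).trans (mul_le_mul_of_nonneg_left ?_ hC₀0)
    have hHi : ∀ x, Real.sqrt (∑ j, ‖Torus.partialDeriv j (Torus.partialDeriv i v) x‖ ^ 2) ^ q ≤
        H x ^ (q / 2) := by
      intro x
      rw [Real.sqrt_eq_rpow, ← Real.rpow_mul (Finset.sum_nonneg fun j _ => sq_nonneg _),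
        show (1 : ℝ) / 2 * q = q / 2 by ring]
      refine Real.rpow_le_rpow (Finset.sum_nonneg fun j _ => sq_nonneg _) ?_ (by positivity)
      rw [hH]
      exact Finset.single_le_sum (f := fun i' => ∑ j, ‖Torus.partialDeriv j
        (Torus.partialDeriv i' v) x‖ ^ 2) (fun i' _ => Finset.sum_nonneg fun j _ => sq_nonneg _)
        (Finset.mem_univ i)
    have hint : ∫ x, Real.sqrt (∑ j, ‖Torus.partialDeriv j (Torus.partialDeriv i v) x‖ ^ 2) ^ q ≤
        ∫ x, H x ^ (q / 2) :=
      integral_mono_of_nonneg (ae_of_all _ fun x => Real.rpow_nonneg (Real.sqrt_nonneg _) _)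
        ((hHc.rpow_const fun x => Or.inr (by positivity)).integrable_unitAddTorus)
        (ae_of_all _ hHi)
    exact Real.rpow_le_rpow (integral_nonneg fun x => Real.rpow_nonneg (Real.sqrt_nonneg _) _)
      hint (by positivity)
  -- `|∇v| ≤ ∑ⱼ ‖∂ⱼv‖` and Minkowski
  have hMink := integral_rpow_le_sum_of_le_sum' (d := d) hs
    (g := fun x => Real.sqrt (∑ j, ‖Torus.partialDeriv j v x‖ ^ 2))
    (G := fun i x => ‖Torus.partialDeriv i v x‖)
    (Real.continuous_sqrt.comp (continuous_finsetSum _ fun j _ =>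
      ((hv.partialDeriv j).continuous.norm).pow 2))
    (fun i => (hv.partialDeriv i).continuous.norm) (fun x => Real.sqrt_nonneg _)
    (fun i x => norm_nonneg _) (fun x => sqrt_sum_sq_le_sum' _ fun j => norm_nonneg _)
  calc (∫ x, Real.sqrt (∑ j, ‖Torus.partialDeriv j v x‖ ^ 2) ^ s) ^ (1 / s)
      ≤ ∑ i, (∫ x, ‖Torus.partialDeriv i v x‖ ^ s) ^ (1 / s) := hMink
    _ ≤ ∑ _i : d, C₀ * B := Finset.sum_le_sum fun i _ => hcomp i
    _ = Fintype.card d * C₀ * B := by rw [Finset.sum_const, Finset.card_univ, nsmul_eq_mul]; ring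

/-! ### The criterion -/

/-- **Gibbon's chessboard, row `n = 2`, squares `(2, q/2)` with `1 < q < 3`, as a sufficient
condition on `T³` (continuation form).** Gibbon 2019, Thm 2 (iii) with Remark 2:
`∫₀ᵀ ‖∇²u‖_{L^{2m}}^{2α_{2,m}} dt < ∞`, `2α_{2,m} = 4m/(6m−3)`, implies that the solution is strong;
here `q = 2m`, the time exponent is `2q/(3(q−1))` (`2/r + 3/q = 3`). Formalised for classical
solutions: let `(u, p)` solve the unforced Navier–Stokes equations with `ν > 0` on `[0, T) × T^d`,
`card d = 3`, `T > 0`, with mean-zero velocity slices, and let `N` be a continuous nonnegative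
majorant of `‖∇²u(t)‖_{L^q}`, `(∫ (∑ᵢ∑ⱼ‖∂ⱼ∂ᵢu(t)‖²)^{q/2})^{1/q} ≤ N(t)`, with
`∫₀ᵗ N^{2q/(3(q−1))} ≤ I` for all `t ∈ [0, T)`. Then the solution continues to a classical
mean-zero solution on some `[0, T'] × T^d`, `T' > T`, equal to `u` on `[0, T)`. Proof (a shorter
road than the printed Appendix B): the Sobolev step `Torus.exists_gradLs_le_hessianLq` at
`s = 3q/(3−q) > 3/2`, and Beirão da Veiga's criterion
`Torus.classicalNS_continuation_of_gradLs_rpow_integral_le` (`2s/(2s−3) = 2q/(3(q−1))`). The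
squares with `q ≥ 3` (`2α_{2,m} ≤ 1`) are not covered; `q = 1` (`s = 3/2`) is the excluded
endpoint of Beirão da Veiga's range.
[cite: Gibbon2019Chessboard, Thm 2 (iii) + Remark 2, row n = 2 (squares (2,m), 1 ≤ m < 3/2)] -/
theorem Torus.classicalNS_continuation_of_hessianLq_rpow_integral_le (hd : Fintype.card d = 3)
    {ν T q : ℝ} (hν : 0 < ν) (hT : 0 < T) (hq : 1 < q) (hq3 : q < 3)
    {u : ℝ → UnitAddTorus d → EuclideanSpace ℝ d} {p : ℝ → UnitAddTorus d → ℝ}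
    (h : Torus.IsClassicalNSSolutionOn (Ico 0 T) ν 0 u p)
    (hmean : ∀ t ∈ Ico 0 T, Torus.HasZeroMean (u t)) {N : ℝ → ℝ}
    (hNc : ContinuousOn N (Ico 0 T)) (hN0 : ∀ t ∈ Ico 0 T, 0 ≤ N t)
    (hN : ∀ t ∈ Ico 0 T,
      (∫ x, (∑ i, ∑ j, ‖Torus.partialDeriv j (Torus.partialDeriv i (u t)) x‖ ^ 2) ^ (q / 2)) ^
          (1 / q) ≤ N t)
    {I : ℝ} (hI : ∀ t ∈ Ico 0 T, ∫ τ in (0 : ℝ)..t, N τ ^ (2 * q / (3 * (q - 1))) ≤ I) :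
    ∃ T' : ℝ, T < T' ∧ ∃ (u' : ℝ → UnitAddTorus d → EuclideanSpace ℝ d)
      (p' : ℝ → UnitAddTorus d → ℝ), Torus.IsClassicalNSSolutionOn (Icc 0 T') ν 0 u' p' ∧
        (∀ t ∈ Icc 0 T', Torus.HasZeroMean (u' t)) ∧ ∀ t ∈ Ico 0 T, u' t = u t := by
  have hq0 : 0 < q := by linarith
  have h3q : 0 < 3 - q := by linarith
  have hq1 : 0 < q - 1 := by linarith
  set s : ℝ := 3 * q / (3 - q) with hs_def
  have hs1 : 1 ≤ s := by
    rw [hs_def, le_div_iff₀ h3q]; linarith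
  have hs32 : 3 / 2 < s := by
    rw [hs_def, lt_div_iff₀ h3q]; linarith
  have hqs : 1 / q - 1 / 3 ≤ 1 / s := by
    rw [hs_def]
    have e : 1 / q - 1 / 3 = 1 / (3 * q / (3 - q)) := by field_simp
    rw [e]
  have hexp : 2 * s / (2 * s - 3) = 2 * q / (3 * (q - 1)) := by
    rw [hs_def]
    have e1 : 2 * (3 * q / (3 - q)) - 3 = (9 * q - 9) / (3 - q) := by field_simp; ring
    rw [e1]
    have h9 : 9 * q - 9 ≠ 0 := by
      intro h0; linarith
    have hq1' : q - 1 ≠ 0 := hq1.ne'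
    field_simp
    ring
  obtain ⟨C, hC0, hC⟩ := Torus.exists_gradLs_le_hessianLq (d := d) hd hq.le hq3 hs1 hqs
  set r : ℝ := 2 * q / (3 * (q - 1)) with hr_def
  -- the transported majorant `C · N`
  have hN' : ∀ t ∈ Ico 0 T,
      (∫ x, Real.sqrt (∑ j, ‖Torus.partialDeriv j (u t) x‖ ^ 2) ^ s) ^ (1 / s) ≤ C * N t := by
    intro t ht
    have hut : Torus.IsSmooth (u t) := h.smooth_velocity.isSmooth_slice ht
    exact (hC (u t) hut).trans (mul_le_mul_of_nonneg_left (hN t ht) hC0)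
  have hI' : ∀ t ∈ Ico 0 T, ∫ τ in (0 : ℝ)..t, (C * N τ) ^ (2 * s / (2 * s - 3)) ≤ C ^ r * I := by
    intro t ht
    rw [hexp]
    have e : ∫ τ in (0 : ℝ)..t, (C * N τ) ^ r = ∫ τ in (0 : ℝ)..t, C ^ r * N τ ^ r := by
      refine intervalIntegral.integral_congr fun τ hτ => ?_
      rw [uIcc_of_le ht.1] at hτ
      have hτ' : τ ∈ Ico 0 T := ⟨hτ.1, hτ.2.trans_lt ht.2⟩
      rw [Real.mul_rpow hC0 (hN0 τ hτ')]
    rw [e, intervalIntegral.integral_const_mul]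
    exact mul_le_mul_of_nonneg_left (hI t ht) (Real.rpow_nonneg hC0 _)
  exact Torus.classicalNS_continuation_of_gradLs_rpow_integral_le hd hν hT hs32 h hmean
    (N := fun t => C * N t) (continuousOn_const.mul hNc) (fun t ht => mul_nonneg hC0 (hN0 t ht))
    hN' hI'

end Literature.Analysis.FluidPDE
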